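import Summits.PneNP.PneNP.Theorems.KarlinRubinMonotoneBlindDnfPlanted

/-!
# Route KarlinRubin, crux `MonotoneBlind` (stmt-PneNP-18027), line `Sketch` (vertex-cover duality): stub `stub_hingeGates`

The gate calculus of fibre densities. For a vertex set `A`, a noise `x` and a test
`f : EdgeVec n → Bool` put `mix A x x' := fun e => if (∀ v ∈ e, v ∈ A) then x' e else x e` (resample the
slots inside `A`) and `dens_f := Pr_{x' ∼ G(n,1/2)}[f (mix A x x') = 1]`.

* (`∨`) `dens_g ≤ dens_{g ∨ h}` — monotonicity of the outer measure
  (`{g ∘ mix = 1} ⊆ {(g || h) ∘ mix = 1}`);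
* (`∧`) for MONOTONE `g h`: `dens_g · dens_h ≤ dens_{g ∧ h}` — the Harris–Kleitman inequality. The events
  `{x' | g (mix A x x') = 1}` and `{x' | h (mix A x x') = 1}` are up-sets of the cube `EdgeVec n`
  (`x' ≤ x'' ⇒ mix A x x' ≤ mix A x x''`), and two up-sets of a uniform Boolean cube are positively
  correlated: Mathlib's `IsUpperSet.le_card_inter_finset` (up-sets of `Finset ι` under `⊆`) transported
  along the support map `y ↦ {i | y i = true}` of the cube `ι → Bool`
  (`card_mul_le_card_inter_of_isUpperSet`, `card_mul_le_of_monotone`), converted into probabilities with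
  `erdosRenyiHalf_toOuterMeasure_eq_card_div` (`erdosRenyiHalf_mul_le_of_card_mul_le`,
  `erdosRenyiHalf_harrisKleitman`).

All `--supports stmt-PneNP-18027`; no definitions.
-/

set_option linter.dupNamespace false -- `Summit.PneNP.PneNP.…` is the layout-mandated namespace (D-0017)

namespace Summit.PneNP.PneNP.Theorems.MonotoneBlind.VertexCover

open Literature.Computability.Complexity Literature.Probability.RandomGraphs.PlantedClique Filter Finset
open scoped ENNReal Topology Classical

/-! ### Harris–Kleitman on the Boolean cube `ι → Bool` -/

section Cube

variable {ι : Type*} [Fintype ι]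

/-- The support map `y ↦ {i | y i = true}` of the cube `ι → Bool` is injective. [folklore] -/
theorem support_filter_injective :
    Function.Injective fun y : ι → Bool => (univ.filter fun i => y i = true) := by
  intro y z hyz
  funext i
  have hi := Finset.ext_iff.1 hyz i
  simp only [mem_filter, mem_univ, true_and] at hi
  exact Bool.eq_iff_iff.2 hi

variable [DecidableEq ι]

/-- The support map sends up-sets of the cube `ι → Bool` (pointwise order, `false < true`) to up-sets
of `Finset ι` (under `⊆`). [folklore] -/
theorem isUpperSet_image_support_filter (U : Finset (ι → Bool))
    (hU : IsUpperSet (U : Set (ι → Bool))) :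
    IsUpperSet ((U.image fun y : ι → Bool => (univ.filter fun i => y i = true)) :
      Set (Finset ι)) := by
  intro s t hst hs
  rw [mem_coe, mem_image] at hs ⊢
  obtain ⟨y, hy, rfl⟩ := hs
  refine ⟨fun i => decide (i ∈ t), hU (fun i => ?_) hy, ?_⟩
  · cases hyi : y i
    · exact Bool.false_le _
    · have hit : i ∈ t := hst (by simpa using hyi)
      simp [hit]
  · ext i
    simp

/-- **Harris–Kleitman on the Boolean cube** (counting form): two up-sets `U V` of `ι → Bool` satisfy
`#U · #V ≤ 2^{#ι} · #(U ∩ V)` (Mathlib's `IsUpperSet.le_card_inter_finset`, transported along the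
support map). [folklore] -/
theorem card_mul_le_card_inter_of_isUpperSet (U V : Finset (ι → Bool))
    (hU : IsUpperSet (U : Set (ι → Bool))) (hV : IsUpperSet (V : Set (ι → Bool))) :
    #U * #V ≤ 2 ^ Fintype.card ι * #(U ∩ V) := by
  have hinj : Function.Injective fun y : ι → Bool => (univ.filter fun i => y i = true) :=
    support_filter_injective
  have h := (isUpperSet_image_support_filter U hU).le_card_inter_finset
    (isUpperSet_image_support_filter V hV)
  rwa [card_image_of_injective _ hinj, card_image_of_injective _ hinj, ← image_inter _ _ hinj,
    card_image_of_injective _ hinj] at h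

/-- For a monotone Boolean test `f` on a preorder, the event `{f = 1}` (as a finset) is an up-set.
[folklore] -/
theorem isUpperSet_coe_filter_eq_true {α : Type*} [Fintype α] [Preorder α] (f : α → Bool)
    (hf : Monotone f) :
    IsUpperSet ((univ.filter fun x : α => x ∈ {y : α | f y = true} : Finset α) : Set α) := by
  intro a b hab ha
  simp only [mem_coe, mem_filter, mem_univ, true_and, Set.mem_setOf_eq] at ha ⊢
  exact (Bool.le_iff_imp.1 (hf hab)) ha

/-- **Harris–Kleitman for monotone Boolean tests on the cube** (counting form):
`#{g = 1} · #{h = 1} ≤ #(ι → Bool) · #{g ∧ h = 1}` for monotone `g h : (ι → Bool) → Bool`. [folklore] -/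
theorem card_mul_le_of_monotone (g h : (ι → Bool) → Bool) (hg : Monotone g) (hh : Monotone h) :
    #(univ.filter fun x : ι → Bool => x ∈ {y : ι → Bool | g y = true}) *
        #(univ.filter fun x : ι → Bool => x ∈ {y : ι → Bool | h y = true}) ≤
      Fintype.card (ι → Bool) *
        #(univ.filter fun x : ι → Bool => x ∈ {y : ι → Bool | (g y && h y) = true}) := by
  rw [Fintype.card_fun, Fintype.card_bool]
  refine (card_mul_le_card_inter_of_isUpperSet _ _ (isUpperSet_coe_filter_eq_true g hg)
    (isUpperSet_coe_filter_eq_true h hh)).trans_eq ?_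
  congr 2
  ext y
  simp

end Cube

/-! ### Probability form under `G(n,1/2)` -/

variable {n : ℕ}

/-- `a · b ≤ N · c` gives `(a / N) · (b / N) ≤ c / N` in `ℝ≥0∞` for a finite nonzero `N`. [folklore] -/
theorem div_mul_div_le_div_of_mul_le {a b c N : ℝ≥0∞} (hN0 : N ≠ 0) (hNtop : N ≠ ⊤)
    (h : a * b ≤ N * c) : a / N * (b / N) ≤ c / N := by
  rw [div_eq_mul_inv, div_eq_mul_inv, div_eq_mul_inv]
  calc a * N⁻¹ * (b * N⁻¹) = a * b * N⁻¹ * N⁻¹ := by ring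
    _ ≤ N * c * N⁻¹ * N⁻¹ := mul_le_mul_left (mul_le_mul_left h _) _
    _ = c * N⁻¹ * (N * N⁻¹) := by ring
    _ = c * N⁻¹ := by rw [ENNReal.mul_inv_cancel hN0 hNtop, mul_one]

/-- A count inequality `#S · #T ≤ #(EdgeVec n) · #R` is the probability inequality
`Pr[S] · Pr[T] ≤ Pr[R]` under `G(n,1/2)`. [folklore] -/
theorem erdosRenyiHalf_mul_le_of_card_mul_le (S T R : Set (EdgeVec n)) [DecidablePred (· ∈ S)]
    [DecidablePred (· ∈ T)] [DecidablePred (· ∈ R)]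
    (h : #(univ.filter fun x : EdgeVec n => x ∈ S) * #(univ.filter fun x : EdgeVec n => x ∈ T) ≤
      Fintype.card (EdgeVec n) * #(univ.filter fun x : EdgeVec n => x ∈ R)) :
    (erdosRenyiHalf n).toOuterMeasure S * (erdosRenyiHalf n).toOuterMeasure T ≤
      (erdosRenyiHalf n).toOuterMeasure R := by
  rw [erdosRenyiHalf_toOuterMeasure_eq_card_div, erdosRenyiHalf_toOuterMeasure_eq_card_div,
    erdosRenyiHalf_toOuterMeasure_eq_card_div]
  refine div_mul_div_le_div_of_mul_le (by exact_mod_cast Fintype.card_ne_zero)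
    (ENNReal.natCast_ne_top _) ?_
  exact_mod_cast h

/-- **Harris–Kleitman for `G(n,1/2)`**: two MONOTONE Boolean tests of the uniform edge vector are
positively correlated, `Pr[g = 1] · Pr[h = 1] ≤ Pr[g ∧ h = 1]` (Harris 1960; Kleitman 1966).
[folklore] -/
theorem erdosRenyiHalf_harrisKleitman (g h : EdgeVec n → Bool) (hg : Monotone g) (hh : Monotone h) :
    (erdosRenyiHalf n).toOuterMeasure {y | g y = true} *
        (erdosRenyiHalf n).toOuterMeasure {y | h y = true} ≤
      (erdosRenyiHalf n).toOuterMeasure {y | (g y && h y) = true} :=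
  erdosRenyiHalf_mul_le_of_card_mul_le _ _ _ (card_mul_le_of_monotone g h hg hh)

/-! ### The stub -/

/-- **stub_hingeGates** (the gate calculus of hinge sets; stub of line `Sketch` of crux
stmt-PneNP-18027). For tests `g h : EdgeVec n → Bool`, a vertex set `A` and a noise `x`, with
`dens_f := Pr_{x'}[f(x outside A, x' inside A) = 1]`:
(∨) `dens_g ≤ dens_{g ∨ h}` (monotonicity of the measure);
(∧) for MONOTONE `g, h`: `dens_g · dens_h ≤ dens_{g ∧ h}` (Harris–Kleitman: the two events are up-sets
of the uniform cube `EdgeVec n`, since resampling inside `A` is monotone in `x'`;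
`erdosRenyiHalf_harrisKleitman`). [folklore] -/
theorem stub_hingeGates :
    (∀ (n : ℕ) (A : Finset (Fin n)) (g h : EdgeVec n → Bool) (x : EdgeVec n),
      (erdosRenyiHalf n).toOuterMeasure
          {x' | g (fun e => if (∀ v ∈ (e : Sym2 (Fin n)), v ∈ A) then x' e else x e) = true} ≤
        (erdosRenyiHalf n).toOuterMeasure
          {x' | (g (fun e => if (∀ v ∈ (e : Sym2 (Fin n)), v ∈ A) then x' e else x e) ||
            h (fun e => if (∀ v ∈ (e : Sym2 (Fin n)), v ∈ A) then x' e else x e)) = true}) ∧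
    (∀ (n : ℕ) (A : Finset (Fin n)) (g h : EdgeVec n → Bool), Monotone g → Monotone h → ∀ x : EdgeVec n,
      (erdosRenyiHalf n).toOuterMeasure
          {x' | g (fun e => if (∀ v ∈ (e : Sym2 (Fin n)), v ∈ A) then x' e else x e) = true} *
        (erdosRenyiHalf n).toOuterMeasure
          {x' | h (fun e => if (∀ v ∈ (e : Sym2 (Fin n)), v ∈ A) then x' e else x e) = true} ≤
      (erdosRenyiHalf n).toOuterMeasure
          {x' | (g (fun e => if (∀ v ∈ (e : Sym2 (Fin n)), v ∈ A) then x' e else x e) &&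
            h (fun e => if (∀ v ∈ (e : Sym2 (Fin n)), v ∈ A) then x' e else x e)) = true}) := by
  refine ⟨fun n A g h x => ?_, fun n A g h hg hh x => ?_⟩
  · exact (erdosRenyiHalf n).toOuterMeasure.mono fun x' hx' => by
      simp only [Set.mem_setOf_eq, Bool.or_eq_true] at hx' ⊢
      exact Or.inl hx'
  · -- resampling inside `A` is monotone in the resampled vector
    have hmix : Monotone fun (x' : EdgeVec n) (e : (⊤ : SimpleGraph (Fin n)).edgeSet) =>
        if (∀ v ∈ (e : Sym2 (Fin n)), v ∈ A) then x' e else x e := by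
      intro y z hyz e
      dsimp only
      split_ifs
      · exact hyz e
      · exact le_rfl
    exact erdosRenyiHalf_harrisKleitman _ _ (hg.comp hmix) (hh.comp hmix)

end Summit.PneNP.PneNP.Theorems.MonotoneBlind.VertexCover
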